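import Summits.ResolutionOfSingularities.ResolutionOfSingularities.Theorems.FrobeniusLadderFInjectiveMacaulayficationGermOfPointFixable
import Summits.ResolutionOfSingularities.ResolutionOfSingularities.Theorems.FrobeniusLadderFInjectiveMacaulayficationFermatCubicConeGerm
import Summits.ResolutionOfSingularities.ResolutionOfSingularities.Theorems.FrobeniusLadderFInjectiveMacaulayficationT4OriginPointFixableChar7
import Summits.ResolutionOfSingularities.ResolutionOfSingularities.Theorems.FrobeniusLadderFInjectiveMacaulayficationT4HypersurfacePrime
import Summits.ResolutionOfSingularities.ResolutionOfSingularities.Theorems.FrobeniusLadderFInjectiveMacaulayficationPointFixableTransport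
import Summits.ResolutionOfSingularities.ResolutionOfSingularities.Theorems.FrobeniusLadderFInjectiveMacaulayficationHypersurfaceRegular
import Summits.ResolutionOfSingularities.ResolutionOfSingularities.Theorems.FrobeniusLadderFInjectiveMacaulayficationQuotLocalizationIso
import Summits.ResolutionOfSingularities.ResolutionOfSingularities.Theorems.FrobeniusLadderFInjectiveMacaulayficationT4GermJacobianChar7
import HarnessLib

/-!
# ★★ THE ORIGIN OF `T⁽⁴⁾/7` IS A KERNEL-CERTIFIED POSITIVE INSTANCE OF THE F-HALF'S GERM FORM AT `d = 4`, INFORMATIVE STRATUM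
# (crux `FInjectiveMacaulayfication` stmt-ResolutionOfSingularities-15315, chain w45a; this seat's second offer 2026-08-28T02:31Z, res-L1-w45a-tri-2 #347
# «S-INSTANCE-worthy»; seat res-L1-w45a-stub-3 g8)

[OURS · L1 W4.5a] Support file (`--supports stmt-ResolutionOfSingularities-15315 --as helper`); replaces the role of NO printed item; NOT a
statement of any manuscript; def-free, no named facts, no `decide` tables of its own. AI-written (AI review is weaker than expert review).

`X = Spec k[x,y,z,w,v]/(g)`, `g = z² + (y²+x³)³ + w⁷ + v⁸ + x¹²` (the hypersurface model of the deciding specimen `T⁽⁴⁾⁺` of road B), `char k = 7`,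
`0` = the origin `(x̄,ȳ,z̄,w̄,v̄)`. THEOREM `t4_origin_germ_instance`: the FIVE point-hypotheses of the germ form
`GermForm.LocalFInjectivizationGerm 7 4` (res-L1-w45a-stub-1 p596392) hold at `(X, 0)` — `0` is closed (H1), NOT regular (H2: `g ≠ 0`, `g(0) = 0`,
`∇g(0) = 0`), `dim 𝒪_{X,0} = 4` (H3), `Spec 𝒪_{X,0}` is regular off its closed point (H4: ISOLATED — §2, Jacobian criterion at every prime
strictly inside the origin, a characteristic-`7` computation), the CM-clause holds at every point of `Spec 𝒪_{X,0}` (H5: hypersurface) — AND the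
conclusion `GermForm.FInjectivizationGermAt 7 0` holds: some `𝓚 ≠ ⊥` on `Spec 𝒪_{X,0}` cosupported at the closed point has ALL its blowings up FULL
(domain ∧ CM-clause ∧ F-clause) at EVERY point. By `GermForm.localFInjectivizationFibreAdmGe4_at_top_iff_germ` this is a positive instance, in exact
currency, of the registered F-half `LocalFullificationFibreAdmGe4Split.LocalFInjectivizationFibreAdmGe4` of door v36.2 at `I = ⊤`, `d = 4`, `p = 7`.

CENSUS LABEL (res-L1-w45a-tri-2 #348 (c) taxonomy): **INFORMATIVE STRATUM «FULL model still singular»** — the certificate behind the conclusion is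
the road-B toric blow-up of res-L1-w45a-tri-1's own fan (537 charts; `T4OriginPointFixableChar7.t4_originPointFixable_char7`, kernel-checked K-loc
cells), and that model is SINGULAR over the origin: e.g. in the chart with rays `{e₀, e₂, e₃, (14,21,63,18,16), (3,4,12,4,3)}` the strict
transform is `y₁² + y₃² + (1 + y₀³y₄)³ + y₂⁷y₄⁴ + y₀¹²y₃⁴²y₄¹²`, singular along the curve `{y₁ = y₂ = y₃ = 0, y₀³y₄ = −1}` over `x = 0` (all five
partials vanish there in characteristic `7`; seat computation on `L/res-L1-w45a-tri-1/tools/fan_T4_own.json`, NOT kernel-certified and not used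
below). Contrast: the Fermat cubic cone instances (`FermatCubicConeGerm`, res-L1-w45a-stub-1) are FULL via a REGULAR model.

## Route
* `T4GermJacobianChar7.exists_pderiv_not_mem` (companion file): for a prime `P ∋ g` of `k[X]` inside the origin and different from it, some `∂ᵢg ∉ P` (`∂₂ = 2z`, `∂₄ = 8v⁷`,
  `∂₁ = 6y(y²+x³)²`, `∂₀ = 9x²(y²+x³)² + 12x¹¹`; if `y²+x³ ∈ P` everything collapses into the origin, else `∂₀ ≡ x⁸(9 + 12x³)` forces a unit into `P`).
* §3 ring-level facts for `R = k[X]/(g)`: the origin is maximal, `R_Q` is regular for `Q ⊊` origin (`HypersurfaceRegular.stub_hypersurfaceRegularOfPderiv`),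
  every `R_Q` satisfies the CM-clause (`Fedder.sop_isWeaklyRegular_quotient` + `QuotLocalizationIso`, as in `FermatCubicConeGerm.cmCl_localization`).
* §4 `originPointFixable`: PFix(𝒪_{X,0}) — the road-B certificate lives on the presentation `k[X]/(range Gs)`, `Gs ≡ g`; it is moved to `k[X]/(g)`
  along `Ideal.quotEquivOfEq` + `Spec.stalkIso` by `PointFixableTransport.pointFixable_of_ringEquiv`.
* §5 `fInjectivizationGermAt_origin` = `GermOfPointFixable.fInjectivizationGermAt_of_pointFixable` (this seat, p600041; through res-L1-w45a-stub-1's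
  `GermOfGlobalBlowup`). §6 the hypotheses H1–H5 (tools of `GermOfGlobalBlowup` §2/§5 and `FermatCubicConeGerm`) and the assembled row.

[folklore mathematics (Jacobian criterion, hypersurfaces are Cohen–Macaulay); OURS as a certificate; cite: Hartshorne1977, I Thm. 5.1; Matsumura1987,
Thm. 14.2, Thm. 17.4, Thm. 17.8; StacksProject, Tag 0804; Temkin2008, §2.1]
-/

-- single-problem summit: the doubled namespace component is forced
set_option linter.dupNamespace false

noncomputable section

namespace Summit.ResolutionOfSingularities.ResolutionOfSingularities.Theorems.FInjectiveMacaulayfication.T4GermChar7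

open AlgebraicGeometry CategoryTheory Literature.AlgebraicGeometry.Resolution TopologicalSpace IsLocalRing MvPolynomial
open Summit.ResolutionOfSingularities.ResolutionOfSingularities.Theorems.FInjectiveMacaulayfication
open SliceableCentre GermForm GermOfGlobalBlowup T4GermJacobianChar7

/-! ## §3 Ring-level facts for `R = k[X₀,…,X₄]/(g)` -/

/-- `g` has no constant term. [folklore] -/
theorem constantCoeff_g (k : Type) [Field k] (g : MvPolynomial (Fin 5) k)
    (hg : g = X 2 ^ 2 + (X 1 ^ 2 + X 0 ^ 3) ^ 3 + X 3 ^ 7 + X 4 ^ 8 + X 0 ^ 12) : constantCoeff g = 0 := by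
  subst hg
  simp [constantCoeff_X]

/-- `g ≠ 0`. [folklore] -/
theorem g_ne_zero (k : Type) [Field k] (g : MvPolynomial (Fin 5) k)
    (hg : g = X 2 ^ 2 + (X 1 ^ 2 + X 0 ^ 3) ^ 3 + X 3 ^ 7 + X 4 ^ 8 + X 0 ^ 12) : g ≠ 0 :=
  (T4HypersurfacePrime.prime_T4_five k g hg).1.ne_zero

/-- The origin `(x̄₀, …, x̄₄)` pulls back to `(X₀, …, X₄)`. [folklore] -/
theorem comap_origin (k : Type) [Field k] (g : MvPolynomial (Fin 5) k)
    (hg : g = X 2 ^ 2 + (X 1 ^ 2 + X 0 ^ 3) ^ 3 + X 3 ^ 7 + X 4 ^ 8 + X 0 ^ 12) :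
    (Ideal.span (Set.range fun j : Fin 5 => Ideal.Quotient.mk (Ideal.span {g}) (X j))).comap (Ideal.Quotient.mk (Ideal.span {g})) =
      Ideal.span (Set.range (X : Fin 5 → MvPolynomial (Fin 5) k)) := by
  rw [FermatCubicConeGerm.span_range_mk_X_eq_map, Ideal.comap_map_of_surjective _ Ideal.Quotient.mk_surjective, sup_eq_left]
  intro q hq
  rw [Ideal.mem_comap, Ideal.mem_bot, Ideal.Quotient.eq_zero_iff_mem, Ideal.mem_span_singleton] at hq
  obtain ⟨c, rfl⟩ := hq
  refine Ideal.mul_mem_right _ _ ?_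
  rw [Fedder.span_range_X_eq_ker, RingHom.mem_ker]
  exact constantCoeff_g k g hg

/-- **The origin `(x̄₀, …, x̄₄)` is a maximal ideal of `R`.** [folklore] -/
theorem isMaximal_origin (k : Type) [Field k] (g : MvPolynomial (Fin 5) k)
    (hg : g = X 2 ^ 2 + (X 1 ^ 2 + X 0 ^ 3) ^ 3 + X 3 ^ 7 + X 4 ^ 8 + X 0 ^ 12) :
    (Ideal.span (Set.range fun j : Fin 5 => Ideal.Quotient.mk (Ideal.span {g}) (X j))).IsMaximal := by
  rw [FermatCubicConeGerm.span_range_mk_X_eq_map]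
  haveI : (Ideal.span (Set.range (X : Fin 5 → MvPolynomial (Fin 5) k))).IsMaximal :=
    QuotientOriginMaximal.idealOfVars_isMaximal k (n := 5)
  refine Ideal.IsMaximal.map_of_surjective_of_ker_le Ideal.Quotient.mk_surjective ?_
  rw [Ideal.mk_ker, Ideal.span_singleton_le_iff_mem, Fedder.span_range_X_eq_ker, RingHom.mem_ker]
  exact constantCoeff_g k g hg

/-- **`R` is regular at every prime STRICTLY inside the origin** (the proper generisations of the origin): Jacobian criterion in the regular
direction (`HypersurfaceRegular.stub_hypersurfaceRegularOfPderiv`) fed by `exists_pderiv_not_mem`. [cite: Hartshorne1977, I Thm. 5.1] -/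
theorem isRegularLocalRing_of_lt_origin (k : Type) [Field k] [CharP k 7] (g : MvPolynomial (Fin 5) k)
    (hg : g = X 2 ^ 2 + (X 1 ^ 2 + X 0 ^ 3) ^ 3 + X 3 ^ 7 + X 4 ^ 8 + X 0 ^ 12)
    (Q : Ideal (MvPolynomial (Fin 5) k ⧸ Ideal.span {g})) [Q.IsPrime]
    (hle : Q ≤ Ideal.span (Set.range fun j : Fin 5 => Ideal.Quotient.mk (Ideal.span {g}) (X j)))
    (hne : Q ≠ Ideal.span (Set.range fun j : Fin 5 => Ideal.Quotient.mk (Ideal.span {g}) (X j))) :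
    IsRegularLocalRing (Localization.AtPrime Q) := by
  set P : Ideal (MvPolynomial (Fin 5) k) := Q.comap (Ideal.Quotient.mk (Ideal.span {g})) with hP
  haveI : P.IsPrime := Ideal.comap_isPrime _ Q
  have hgP : g ∈ P := by
    rw [hP, Ideal.mem_comap, Ideal.Quotient.eq_zero_iff_mem.mpr (Ideal.mem_span_singleton_self g)]
    exact Q.zero_mem
  have hP0 : ∀ q ∈ P, constantCoeff q = 0 := by
    intro q hq
    have : q ∈ Ideal.span (Set.range (X : Fin 5 → MvPolynomial (Fin 5) k)) := by
      rw [← comap_origin k g hg]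
      exact Ideal.comap_mono hle hq
    rwa [Fedder.span_range_X_eq_ker, RingHom.mem_ker] at this
  have hneP : ∃ i : Fin 5, (X i : MvPolynomial (Fin 5) k) ∉ P := by
    by_contra hall
    push Not at hall
    apply hne (le_antisymm hle ?_)
    rw [Ideal.span_le]
    rintro _ ⟨j, rfl⟩
    exact hall j
  obtain ⟨i, hi⟩ := exists_pderiv_not_mem k g hg P hgP hP0 hneP
  exact HypersurfaceRegular.stub_hypersurfaceRegularOfPderiv k 5 g i Q hi

/-- **Every local ring of `R` satisfies the CM-clause** (a hypersurface in the regular local ring `k[X]_P`; `Fedder.sop_isWeaklyRegular_quotient`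
transported along `k[X]_P/(g) ≅ R_Q`, as in `FermatCubicConeGerm.cmCl_localization`). [cite: Matsumura1987, Thm. 17.4 (iii) and Thm. 17.8] -/
theorem cmCl_localization (k : Type) [Field k] (g : MvPolynomial (Fin 5) k)
    (hg : g = X 2 ^ 2 + (X 1 ^ 2 + X 0 ^ 3) ^ 3 + X 3 ^ 7 + X 4 ^ 8 + X 0 ^ 12)
    (v : Spec (.of (MvPolynomial (Fin 5) k ⧸ Ideal.span {g}))) :
    CMCl (Localization.AtPrime v.asIdeal) := by
  set P : Ideal (MvPolynomial (Fin 5) k) := v.asIdeal.comap (Ideal.Quotient.mk (Ideal.span {g})) with hPdef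
  haveI : IsRegularLocalRing (Localization.AtPrime P) := IsRegularRing.isRegularLocalRing_localization P
  have hf0 : g ≠ 0 := g_ne_zero k g hg
  have hfP : g ∈ P := by
    rw [hPdef, Ideal.mem_comap, Ideal.Quotient.eq_zero_iff_mem.mpr (Ideal.mem_span_singleton_self g)]
    exact v.asIdeal.zero_mem
  have hinj : Function.Injective (algebraMap (MvPolynomial (Fin 5) k) (Localization.AtPrime P)) :=
    IsLocalization.injective (Localization.AtPrime P) P.primeCompl_le_nonZeroDivisors
  have hfm : algebraMap (MvPolynomial (Fin 5) k) (Localization.AtPrime P) g ∈ maximalIdeal (Localization.AtPrime P) := by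
    rw [← IsLocalization.AtPrime.map_eq_maximalIdeal P (Localization.AtPrime P)]
    exact Ideal.mem_map_of_mem _ hfP
  have hf0' : algebraMap (MvPolynomial (Fin 5) k) (Localization.AtPrime P) g ≠ 0 := fun h =>
    hf0 (hinj (by rw [h, map_zero]))
  have hCM : CMCl (Localization.AtPrime P ⧸ Ideal.span {algebraMap (MvPolynomial (Fin 5) k) (Localization.AtPrime P) g}) :=
    fun d hd s hs => Fedder.sop_isWeaklyRegular_quotient hfm hf0' d hd s hs
  obtain ⟨e⟩ := QuotLocalizationIso.stub_quotLocalizationIso (MvPolynomial (Fin 5) k) g P v.asIdeal rfl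
  exact cmClause_of_ringEquiv e hCM

/-! ## §4 PFix at the origin of `Spec R`, transported from the road-B certificate's presentation `k[X]/(range Gs)` -/

/-- The origin of `k[X]/(range Fs)` pulls back to `(X₀,…,X₄)` when the `Fs` vanish at `0`. [folklore] -/
theorem comap_origin_range (k : Type) [Field k] {r : ℕ} (Fs : Fin r → MvPolynomial (Fin 5) k) (hF : ∀ l, constantCoeff (Fs l) = 0) :
    (Ideal.span (Set.range fun j : Fin 5 => Ideal.Quotient.mk (Ideal.span (Set.range Fs)) (X j))).comap
        (Ideal.Quotient.mk (Ideal.span (Set.range Fs))) = Ideal.span (Set.range (X : Fin 5 → MvPolynomial (Fin 5) k)) := by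
  rw [QuotientOriginMaximal.span_range_mk_X_eq_map, Ideal.comap_map_of_surjective _ Ideal.Quotient.mk_surjective, sup_eq_left,
    idealOfVars]
  intro q hq
  rw [Ideal.mem_comap, Ideal.mem_bot, Ideal.Quotient.eq_zero_iff_mem] at hq
  exact QuotientOriginMaximal.span_range_le_idealOfVars k Fs hF hq

set_option maxHeartbeats 2000000 in -- the PFix statement is large; the transport unifies it twice
/-- **PFix(𝒪_{X,0}) for `X = Spec k[X]/(g)`, `char k = 7`**: the road-B instance `T4OriginPointFixableChar7.t4_originPointFixable_char7` (537 toric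
charts, presentation `k[X]/(range Gs)` with `Gs ≡ g`) transported to the principal presentation `k[X]/(g)` along the stalk isomorphism induced by
`Ideal.quotEquivOfEq` (`PointFixableTransport.pointFixable_of_ringEquiv`). [OURS certificate, folklore transport] -/
theorem originPointFixable (k : Type) [Field k] [CharP k 7] (g : MvPolynomial (Fin 5) k)
    (hg : g = X 2 ^ 2 + (X 1 ^ 2 + X 0 ^ 3) ^ 3 + X 3 ^ 7 + X 4 ^ 8 + X 0 ^ 12)
    (b : Spec (.of (MvPolynomial (Fin 5) k ⧸ Ideal.span {g})))
    (hb : b.asIdeal = Ideal.span (Set.range fun j : Fin 5 => Ideal.Quotient.mk (Ideal.span {g}) (X j))) :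
    ∃ (n : ℕ) (c : Fin n → (Spec (.of (MvPolynomial (Fin 5) k ⧸ Ideal.span {g}))).presheaf.stalk b),
      Ideal.span (Set.range c) ≠ ⊥ ∧
      (Ideal.span (Set.range c)).radical = maximalIdeal ((Spec (.of (MvPolynomial (Fin 5) k ⧸ Ideal.span {g}))).presheaf.stalk b) ∧
      ∀ (j : Fin n) (𝔔 : PrimeSpectrum (blowupAlgebra (Ideal.span (Set.range c)) (c j))),
        𝔔.asIdeal.comap (algebraMap _ (blowupAlgebra (Ideal.span (Set.range c)) (c j))) =
          maximalIdeal ((Spec (.of (MvPolynomial (Fin 5) k ⧸ Ideal.span {g}))).presheaf.stalk b) →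
        IsDomain (Localization.AtPrime 𝔔.asIdeal) ∧ ∀ dd : ℕ, ringKrullDim (Localization.AtPrime 𝔔.asIdeal) = dd →
          ∀ s : Fin dd → Localization.AtPrime 𝔔.asIdeal, (Ideal.span (Set.range s)).radical.IsMaximal →
            RingTheory.Sequence.IsWeaklyRegular (Localization.AtPrime 𝔔.asIdeal) (List.ofFn s) ∧
            ∀ y : Localization.AtPrime 𝔔.asIdeal, (∃ e : ℕ, y ^ 7 ^ e ∈ Ideal.span
              ((fun z : Localization.AtPrime 𝔔.asIdeal => z ^ 7 ^ e) ''
                (Ideal.span (Set.range s) : Set (Localization.AtPrime 𝔔.asIdeal)))) → y ∈ Ideal.span (Set.range s) := by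
  classical
  -- the certificate's presentation: `Gs ≡ g`
  let Gs : Fin 1 → MvPolynomial (Fin 5) k := fun _ => g
  have hG : Gs 0 = X 2 ^ 2 + (X 1 ^ 2 + X 0 ^ 3) ^ 3 + X 3 ^ 7 + X 4 ^ 8 + X 0 ^ 12 := hg
  have hspan : Ideal.span (Set.range Gs) = Ideal.span {g} := by
    rw [show Set.range Gs = {g} from Set.range_const]
  have hF : ∀ l, constantCoeff (Gs l) = 0 := fun _ => constantCoeff_g k g hg
  haveI hmaxGs := QuotientOriginMaximal.isMaximal_span_range_mk_X k Gs hF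
  let bGs : Spec (.of (MvPolynomial (Fin 5) k ⧸ Ideal.span (Set.range Gs))) :=
    ⟨Ideal.span (Set.range fun j : Fin 5 => Ideal.Quotient.mk (Ideal.span (Set.range Gs)) (X j)), hmaxGs.isPrime⟩
  have hfixGs := T4OriginPointFixableChar7.t4_originPointFixable_char7 k Gs hG bGs rfl
  -- the ring isomorphism of the two presentations and the induced isomorphism of the local rings at the origins
  let e₀ : (MvPolynomial (Fin 5) k ⧸ Ideal.span (Set.range Gs)) ≃+* (MvPolynomial (Fin 5) k ⧸ Ideal.span {g}) :=
    Ideal.quotEquivOfEq hspan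
  have hmem : ∀ x, e₀ x ∈ b.asIdeal ↔ x ∈ bGs.asIdeal := by
    intro x
    obtain ⟨q, rfl⟩ := Ideal.Quotient.mk_surjective x
    rw [show e₀ (Ideal.Quotient.mk _ q) = Ideal.Quotient.mk (Ideal.span {g}) q from Ideal.quotEquivOfEq_mk _ _, hb,
      ← Ideal.mem_comap, comap_origin k g hg, ← Ideal.mem_comap,
      show bGs.asIdeal = Ideal.span (Set.range fun j : Fin 5 => Ideal.Quotient.mk (Ideal.span (Set.range Gs)) (X j)) from rfl,
      comap_origin_range k Gs hF]
  obtain ⟨eL⟩ := BlowupFiModelOfCover.nonempty_ringEquiv_localization_of_ringEquiv e₀ bGs.asIdeal b.asIdeal hmem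
  let e : (Spec (.of (MvPolynomial (Fin 5) k ⧸ Ideal.span (Set.range Gs)))).presheaf.stalk bGs ≃+*
      (Spec (.of (MvPolynomial (Fin 5) k ⧸ Ideal.span {g}))).presheaf.stalk b :=
    ((Spec.stalkIso (.of (MvPolynomial (Fin 5) k ⧸ Ideal.span (Set.range Gs))) bGs).commRingCatIsoToRingEquiv.trans eL).trans
      (Spec.stalkIso (.of (MvPolynomial (Fin 5) k ⧸ Ideal.span {g})) b).commRingCatIsoToRingEquiv.symm
  exact PointFixableTransport.pointFixable_of_ringEquiv 7 e hfixGs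

/-! ## §5 The scheme `X = Spec k[X]/(g)` and the germ conclusion at the origin -/

/-- `X` is integral. [folklore] -/
theorem isIntegral_T4 (k : Type) [Field k] (g : MvPolynomial (Fin 5) k)
    (hg : g = X 2 ^ 2 + (X 1 ^ 2 + X 0 ^ 3) ^ 3 + X 3 ^ 7 + X 4 ^ 8 + X 0 ^ 12) :
    IsIntegral (Spec (.of (MvPolynomial (Fin 5) k ⧸ Ideal.span {g}))) := by
  haveI := T4HypersurfacePrime.isPrime_span_T4 k g hg
  haveI : IsDomain (MvPolynomial (Fin 5) k ⧸ Ideal.span {g}) := Ideal.Quotient.isDomain _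
  infer_instance

/-- **`X` is regular at every proper generisation of the origin** (the germ at the origin is an ISOLATED singularity). [cite: Hartshorne1977, I Thm. 5.1] -/
theorem regular_of_specializes_origin (k : Type) [Field k] [CharP k 7] (g : MvPolynomial (Fin 5) k)
    (hg : g = X 2 ^ 2 + (X 1 ^ 2 + X 0 ^ 3) ^ 3 + X 3 ^ 7 + X 4 ^ 8 + X 0 ^ 12)
    (b : Spec (.of (MvPolynomial (Fin 5) k ⧸ Ideal.span {g})))
    (hb : b.asIdeal = Ideal.span (Set.range fun j : Fin 5 => Ideal.Quotient.mk (Ideal.span {g}) (X j))) :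
    ∀ y : Spec (.of (MvPolynomial (Fin 5) k ⧸ Ideal.span {g})), y ⤳ b → y ≠ b →
      y ∈ Scheme.regularLocus (Spec (.of (MvPolynomial (Fin 5) k ⧸ Ideal.span {g}))) := by
  intro y hy hne
  refine FermatCubicConeGerm.mem_regularLocus_Spec_of_isRegularLocalRing y ?_
  have hle : y.asIdeal ≤ b.asIdeal := (PrimeSpectrum.le_iff_specializes y b).mpr hy
  refine isRegularLocalRing_of_lt_origin k g hg y.asIdeal (hb ▸ hle) fun h => hne (PrimeSpectrum.ext ?_)
  rw [h, hb]

/-- ★ **`GermForm.FInjectivizationGermAt 7 0` AT THE ORIGIN OF `T⁽⁴⁾ = V(z² + (y²+x³)³ + w⁷ + v⁸ + x¹²) ⊂ 𝔸⁵`, char `7`**: the 537-chart road-B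
certificate (`T4OriginPointFixableChar7`) in the F-half's germ currency, through `GermOfPointFixable.fInjectivizationGermAt_of_pointFixable`.
INFORMATIVE STRATUM: the certifying FULL model is singular over the origin (seat computation on the fan; see the module docstring), unlike a resolution.
[OURS certificate; folklore assembly] -/
theorem fInjectivizationGermAt_origin (k : Type) [Field k] [CharP k 7] (g : MvPolynomial (Fin 5) k)
    (hg : g = X 2 ^ 2 + (X 1 ^ 2 + X 0 ^ 3) ^ 3 + X 3 ^ 7 + X 4 ^ 8 + X 0 ^ 12)
    (b : Spec (.of (MvPolynomial (Fin 5) k ⧸ Ideal.span {g})))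
    (hb : b.asIdeal = Ideal.span (Set.range fun j : Fin 5 => Ideal.Quotient.mk (Ideal.span {g}) (X j))) :
    FInjectivizationGermAt 7 b := by
  haveI : Fact (Nat.Prime 7) := ⟨by norm_num⟩
  haveI := isIntegral_T4 k g hg
  haveI := FermatCubicConeGerm.structureMorphism_locallyOfFiniteType k g
  have hbcl : IsClosed ({b} : Set (Spec (.of (MvPolynomial (Fin 5) k ⧸ Ideal.span {g})))) :=
    (PrimeSpectrum.isClosed_singleton_iff_isMaximal b).mpr (hb ▸ isMaximal_origin k g hg)
  exact GermOfPointFixable.fInjectivizationGermAt_of_pointFixable 7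
    (Spec.map (CommRingCat.ofHom (algebraMap k (MvPolynomial (Fin 5) k ⧸ Ideal.span {g})))) b hbcl
    (regular_of_specializes_origin k g hg b hb) (originPointFixable k g hg b hb)

/-! ## §6 The five hypotheses of the germ form at the origin, and the assembled row -/

/-- (H2) **The origin is NOT a regular point**: `g ≠ 0`, `g(0) = 0`, `∇g(0) = 0`. [cite: Hartshorne1977, I Thm. 5.1; Matsumura1987, Thm. 14.2] -/
theorem origin_not_mem_regularLocus (k : Type) [Field k] [CharP k 7] (g : MvPolynomial (Fin 5) k)
    (hg : g = X 2 ^ 2 + (X 1 ^ 2 + X 0 ^ 3) ^ 3 + X 3 ^ 7 + X 4 ^ 8 + X 0 ^ 12)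
    (b : Spec (.of (MvPolynomial (Fin 5) k ⧸ Ideal.span {g})))
    (hb : b.asIdeal = Ideal.span (Set.range fun j : Fin 5 => Ideal.Quotient.mk (Ideal.span {g}) (X j))) :
    b ∉ Scheme.regularLocus (Spec (.of (MvPolynomial (Fin 5) k ⧸ Ideal.span {g}))) := by
  classical
  refine not_mem_regularLocus_Spec_of_not_isRegularLocalRing b ?_
  refine not_isRegularLocalRing_localization_of_pderiv_eval_eq_zero (0 : Fin 5 → k) (g_ne_zero k g hg) ?_ ?_ b.asIdeal ?_
  · rw [MvPolynomial.eval_zero]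
    exact constantCoeff_g k g hg
  · intro j
    rw [MvPolynomial.eval_zero]
    subst hg
    fin_cases j
    · show constantCoeff (pderiv (0 : Fin 5) (X 2 ^ 2 + (X 1 ^ 2 + X 0 ^ 3) ^ 3 + X 3 ^ 7 + X 4 ^ 8 + X 0 ^ 12 : MvPolynomial (Fin 5) k)) = 0
      rw [pderiv_zero_t4]; simp [constantCoeff_X]
    · show constantCoeff (pderiv (1 : Fin 5) (X 2 ^ 2 + (X 1 ^ 2 + X 0 ^ 3) ^ 3 + X 3 ^ 7 + X 4 ^ 8 + X 0 ^ 12 : MvPolynomial (Fin 5) k)) = 0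
      rw [pderiv_one_t4]; simp [constantCoeff_X]
    · show constantCoeff (pderiv (2 : Fin 5) (X 2 ^ 2 + (X 1 ^ 2 + X 0 ^ 3) ^ 3 + X 3 ^ 7 + X 4 ^ 8 + X 0 ^ 12 : MvPolynomial (Fin 5) k)) = 0
      rw [pderiv_two_t4]; simp [constantCoeff_X]
    · show constantCoeff (pderiv (3 : Fin 5) (X 2 ^ 2 + (X 1 ^ 2 + X 0 ^ 3) ^ 3 + X 3 ^ 7 + X 4 ^ 8 + X 0 ^ 12 : MvPolynomial (Fin 5) k)) = 0
      rw [pderiv_three_t4]; simp [constantCoeff_X]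
    · show constantCoeff (pderiv (4 : Fin 5) (X 2 ^ 2 + (X 1 ^ 2 + X 0 ^ 3) ^ 3 + X 3 ^ 7 + X 4 ^ 8 + X 0 ^ 12 : MvPolynomial (Fin 5) k)) = 0
      rw [pderiv_four_t4]; simp [constantCoeff_X]
  · rw [hb, comap_origin k g hg, MvPolynomial.eval_zero, Fedder.span_range_X_eq_ker]

/-- (H3) **`dim 𝒪_{X,0} = 4`** (hypersurface in `𝔸⁵`, closed point). [cite: Matsumura1987, §5 Ex. 5.1 and Thm. 13.5] -/
theorem ringKrullDim_stalk_origin (k : Type) [Field k] (g : MvPolynomial (Fin 5) k)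
    (hg : g = X 2 ^ 2 + (X 1 ^ 2 + X 0 ^ 3) ^ 3 + X 3 ^ 7 + X 4 ^ 8 + X 0 ^ 12)
    (b : Spec (.of (MvPolynomial (Fin 5) k ⧸ Ideal.span {g})))
    (hb : b.asIdeal = Ideal.span (Set.range fun j : Fin 5 => Ideal.Quotient.mk (Ideal.span {g}) (X j))) :
    ringKrullDim ((Spec (.of (MvPolynomial (Fin 5) k ⧸ Ideal.span {g}))).presheaf.stalk b) = (4 : ℕ) := by
  haveI : b.asIdeal.IsMaximal := hb ▸ isMaximal_origin k g hg
  rw [ringKrullDim_stalk_Spec_eq]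
  exact HypersurfaceLocalDim.stub_hypersurfaceLocalDim k 4 g (g_ne_zero k g hg) b.asIdeal

/-- (H4) **ISOLATED: `Spec 𝒪_{X,0}` is regular off its closed point.** [cite: Hartshorne1977, I Thm. 5.1; Temkin2008, §2.1] -/
theorem regular_off_closedPoint_origin (k : Type) [Field k] [CharP k 7] (g : MvPolynomial (Fin 5) k)
    (hg : g = X 2 ^ 2 + (X 1 ^ 2 + X 0 ^ 3) ^ 3 + X 3 ^ 7 + X 4 ^ 8 + X 0 ^ 12)
    (b : Spec (.of (MvPolynomial (Fin 5) k ⧸ Ideal.span {g})))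
    (hb : b.asIdeal = Ideal.span (Set.range fun j : Fin 5 => Ideal.Quotient.mk (Ideal.span {g}) (X j))) :
    ∀ s : Spec ((Spec (.of (MvPolynomial (Fin 5) k ⧸ Ideal.span {g}))).presheaf.stalk b),
      s ≠ closedPoint _ → s ∈ Scheme.regularLocus (Spec ((Spec (.of (MvPolynomial (Fin 5) k ⧸ Ideal.span {g}))).presheaf.stalk b)) :=
  regularLocus_Spec_stalk_of_isolated b (regular_of_specializes_origin k g hg b hb)

/-- (H5) **The CM-clause at EVERY point of `Spec 𝒪_{X,0}`** (hypersurface). [cite: Matsumura1987, Thm. 17.4 and Thm. 17.8] -/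
theorem cmCl_Spec_stalk_origin (k : Type) [Field k] [CharP k 7] (g : MvPolynomial (Fin 5) k)
    (hg : g = X 2 ^ 2 + (X 1 ^ 2 + X 0 ^ 3) ^ 3 + X 3 ^ 7 + X 4 ^ 8 + X 0 ^ 12)
    (b : Spec (.of (MvPolynomial (Fin 5) k ⧸ Ideal.span {g})))
    (hb : b.asIdeal = Ideal.span (Set.range fun j : Fin 5 => Ideal.Quotient.mk (Ideal.span {g}) (X j))) :
    ∀ s : Spec ((Spec (.of (MvPolynomial (Fin 5) k ⧸ Ideal.span {g}))).presheaf.stalk b),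
      CMCl ((Spec ((Spec (.of (MvPolynomial (Fin 5) k ⧸ Ideal.span {g}))).presheaf.stalk b)).presheaf.stalk s) :=
  cmCl_Spec_stalk_of_isolated b (cmCl_stalk_Spec_of_cmCl_localization b (cmCl_localization k g hg b))
    (regular_of_specializes_origin k g hg b hb)

/-- ★★ **THE ORIGIN OF `T⁽⁴⁾/7` IS A POSITIVE INSTANCE OF THE F-HALF'S GERM FORM AT `d = 4` — INFORMATIVE STRATUM.** For every field `k` of
characteristic `7`, `X = Spec k[x,y,z,w,v]/(z² + (y²+x³)³ + w⁷ + v⁸ + x¹²)` and its origin `0`: ALL FIVE point-hypotheses of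
`GermForm.LocalFInjectivizationGerm 7 4` hold at `(X, 0)` — `0` closed, `0 ∉ Reg X`, `dim 𝒪_{X,0} = 4`, `Spec 𝒪_{X,0}` regular off its closed point,
CM-clause at every point of `Spec 𝒪_{X,0}` — AND its conclusion `FInjectivizationGermAt 7 0` holds (scheme-level binders: `isIntegral_T4`,
`FermatCubicConeGerm.structureMorphism_isSeparated / _quasiCompact / _locallyOfFiniteType`). Hence a kernel-certified positive instance of the
registered F-half `LocalFullificationFibreAdmGe4Split.LocalFInjectivizationFibreAdmGe4` at `I = ⊤`, level `d = 4`, in exact currency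
(`GermForm.localFInjectivizationFibreAdmGe4_at_top_iff_germ`), whose certifying FULL model (the 537-chart toric blow-up of road B) is SINGULAR over
the origin — the stratum where the F-half has content beyond resolution. [OURS certificate; folklore assembly] -/
theorem t4_origin_germ_instance (k : Type) [Field k] [CharP k 7] (g : MvPolynomial (Fin 5) k)
    (hg : g = X 2 ^ 2 + (X 1 ^ 2 + X 0 ^ 3) ^ 3 + X 3 ^ 7 + X 4 ^ 8 + X 0 ^ 12)
    (b : Spec (.of (MvPolynomial (Fin 5) k ⧸ Ideal.span {g})))
    (hb : b.asIdeal = Ideal.span (Set.range fun j : Fin 5 => Ideal.Quotient.mk (Ideal.span {g}) (X j))) :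
    IsClosed ({b} : Set (Spec (.of (MvPolynomial (Fin 5) k ⧸ Ideal.span {g})))) ∧
    b ∉ Scheme.regularLocus (Spec (.of (MvPolynomial (Fin 5) k ⧸ Ideal.span {g}))) ∧
    ringKrullDim ((Spec (.of (MvPolynomial (Fin 5) k ⧸ Ideal.span {g}))).presheaf.stalk b) = (4 : ℕ) ∧
    (∀ s : Spec ((Spec (.of (MvPolynomial (Fin 5) k ⧸ Ideal.span {g}))).presheaf.stalk b), s ≠ closedPoint _ →
      s ∈ Scheme.regularLocus (Spec ((Spec (.of (MvPolynomial (Fin 5) k ⧸ Ideal.span {g}))).presheaf.stalk b))) ∧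
    (∀ s : Spec ((Spec (.of (MvPolynomial (Fin 5) k ⧸ Ideal.span {g}))).presheaf.stalk b),
      CMCl ((Spec ((Spec (.of (MvPolynomial (Fin 5) k ⧸ Ideal.span {g}))).presheaf.stalk b)).presheaf.stalk s)) ∧
    FInjectivizationGermAt 7 b :=
  ⟨(PrimeSpectrum.isClosed_singleton_iff_isMaximal b).mpr (hb ▸ isMaximal_origin k g hg), origin_not_mem_regularLocus k g hg b hb,
    ringKrullDim_stalk_origin k g hg b hb, regular_off_closedPoint_origin k g hg b hb, cmCl_Spec_stalk_origin k g hg b hb,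
    fInjectivizationGermAt_origin k g hg b hb⟩

/-- **The origin exists** as a point of `X`. [folklore] -/
theorem exists_origin (k : Type) [Field k] (g : MvPolynomial (Fin 5) k)
    (hg : g = X 2 ^ 2 + (X 1 ^ 2 + X 0 ^ 3) ^ 3 + X 3 ^ 7 + X 4 ^ 8 + X 0 ^ 12) :
    ∃ b : Spec (.of (MvPolynomial (Fin 5) k ⧸ Ideal.span {g})),
      b.asIdeal = Ideal.span (Set.range fun j : Fin 5 => Ideal.Quotient.mk (Ideal.span {g}) (X j)) :=
  ⟨⟨_, (isMaximal_origin k g hg).isPrime⟩, rfl⟩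

end Summit.ResolutionOfSingularities.ResolutionOfSingularities.Theorems.FInjectiveMacaulayfication.T4GermChar7

end
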